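import Mathlib

/-!
# Venture HSemireg — THEOREM EQD at n = 4 (equidistribution of sign vectors) and **M_min(4) = 64**: the (d5) count of the signed
# § g = 8, FILED VERBATIM from t-22 g5's kernel file (the n = 4 part)

HONEST FRAMING. Part of the Lean index of the computation cell `pub-hsemireg` (filed by the Sunday typer seat p9, § g = 8; AUTHOR of
the mathematics and of the Lean text: seat t-22 g5, folder-local file `EQD.lean` sha256/16 `91feb766668004a7`, 1 152 l., kept at
`target-g8/t21/reruns/EQD_t22_91feb766668004a7.lean`, re-checked rc 0 with standard axioms by t-21 g8 — «Lean kernel ×2 across seats»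
in VERDICT-G6.md v1.0 `1651dcc7322662a2` § g = 8 (d5) and CENSUS-g8 rows P22-5′ ∕ P22-6). FINITE CHARACTER SUMS over `(ZMod 3)^4 ×
Bool^4` ONLY: no variety, no sheaf, no semiregularity map; nothing here says that HC ∕ HC_CM ∕ HC_AV holds; no Literature fact is
declared or used. The BRIDGE «h-free ∧ pure-Weil ∧ W-alive positive slanted design on E_K⁸ ⟺ a non-negative integral design with
(M_S) for all proper non-empty S and (T) with a zero-sum f ≠ 0» is s0-3's MODEL THEOREM (target-g8/t22/out/slant/README.md §1;
THEOREM HOOK-Z ∕ SQ lineage, door P of the g = 8 census) and is NOT part of this file — exactly as the source file says.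

WHAT IS CUT (verbatim, namespace `T22g5EQD` ↦ `Summit.Ventures.HSemireg.EQD`, seven one-line docstrings added — `σ_true`, `σ_false`,
`one_add_σ_mul_σ`, `chi_empty`, `abs_chi`, `acode`, `abs_total_ge_two` — and the source's `set_option Elab.async false` dropped with the
n = 5 part it served; nothing else changed):
the core (`σ`, `chi`, `orth`, `eqd_core`, `colsum_of_fibres`, `sum_total`, `mass_lower_bound`, `eqd`, `two_pow_dvd_mass`,
`mass_ge_64_at_n4`), the exhibited 64-atom design (`D64`, `m64`, `design64_valid` by kernel `decide`, t-22's resource options kept),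
`Mmin4_eq_64`, and the all-alphabets headline `Mmin4_eq_64_all_alphabets`. NOT cut (they stay in the source file): the n = 2 ∕ 3
bench designs, the n = 5 bound and the 192-atom design (M_min(5) = 192), COROLLARY EQD-H (slabs), SPECTRUM(4) ∕ SPECTRUM(5).
The source's module docstring follows.

# THEOREM EQD (equidistribution of sign vectors) — kernel check (t-22 g5, 2026-08-23)

Setting = the slanted-alphabet design model of `target-g8/t22/out/slant/README.md` §1: a design is `m : sites → sign vectors → ℤ`;
for a set of coordinates `S` the character is `χ_S(s) = ∏_{k ∈ S} σ(s k)` with `σ(true) = -1`, `σ(false) = 1`; the axioms are the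
fibre-sum identities `(M_S)` for every proper non-empty `S` and `(T)` with a zero-sum `f`.

* `orth`        : `∑_{S ⊆ [n]} χ_S(s) χ_S(a) = 2^n · [a = s]` (character orthogonality on `{±1}^n`).
* `eqd_core`    : if the column sums `∑_z F_S(z)` vanish for every non-empty `S` (sites of any finite type),
                  then `2^n · N_s = M` for every sign vector `s`.
* `colsum_of_fibres` : `(M_S)` on every fibre of the restriction `z ↦ z|_S` gives `∑_z F_S(z) = 0`.
* `sum_total`   : `∑_{z ∈ (ZMod 3)^(n+1)} g(∑_k z_k) = 3^n (g 0 + g 1 + g 2)`; `sum_f_total_eq_zero` for zero-sum `f`.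
* `mass_lower_bound` : `(T)` + `m ≥ 0` ⇒ `M ≥ 3^n (|f 0| + |f 1| + |f 2|)`.
* `eqd`         : the theorem in the model's own terms (sites `Fin (n+1) → ZMod 3`); `two_pow_dvd_mass` : `2^(n+1) ∣ M`.
* `mass_ge_64_at_n4` : `M ≥ 64` at `n = 4` (|f| of total mass 2); `design64_valid` + `Mmin4_eq_64` : the exhibited mass-64 design
  ⇒ **M_min(4) = 64 EXACT**; `Mmin4_eq_64_all_alphabets` : the same for every zero-sum `f ≠ 0`.
-/

open Finset

namespace Summit.Ventures.HSemireg.EQD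

/-- sign of a Boolean coordinate: `true ↦ -1`, `false ↦ 1`. -/
def σ (b : Bool) : ℤ := if b then -1 else 1

/-- `σ true = -1`. -/
@[simp] lemma σ_true : σ true = -1 := rfl
/-- `σ false = 1`. -/
@[simp] lemma σ_false : σ false = 1 := rfl

/-- the character `χ_S(s) = ∏_{k ∈ S} σ(s k)`. -/
def chi {n : ℕ} (S : Finset (Fin n)) (s : Fin n → Bool) : ℤ := ∏ k ∈ S, σ (s k)

/-- `σ a σ b + 1 = 2·[a = b]`. -/
lemma one_add_σ_mul_σ (a b : Bool) : σ a * σ b + 1 = if a = b then 2 else 0 := by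
  cases a <;> cases b <;> simp [σ]

/-- `χ_∅ = 1`. -/
lemma chi_empty {n : ℕ} (s : Fin n → Bool) : chi (∅ : Finset (Fin n)) s = 1 := by
  simp [chi]

/-- character orthogonality on `{±1}^n`. -/
theorem orth {n : ℕ} (s a : Fin n → Bool) :
    ∑ S ∈ (univ : Finset (Fin n)).powerset, chi S s * chi S a = if a = s then (2 : ℤ) ^ n else 0 := by
  have key : ∏ k : Fin n, (σ (s k) * σ (a k) + 1)
      = ∑ S ∈ (univ : Finset (Fin n)).powerset, chi S s * chi S a := by
    rw [Finset.prod_add]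
    refine Finset.sum_congr rfl (fun S _ => ?_)
    simp [chi, Finset.prod_mul_distrib]
  rw [← key]
  by_cases h : a = s
  · subst h
    simp only [if_true]
    have : ∀ k : Fin n, σ (a k) * σ (a k) + 1 = 2 := fun k => by simp [one_add_σ_mul_σ]
    simp [this, Finset.prod_const]
  · simp only [h, if_false]
    obtain ⟨k, hk⟩ : ∃ k, a k ≠ s k := by
      by_contra hc; push Not at hc; exact h (funext hc)
    apply Finset.prod_eq_zero (Finset.mem_univ k)
    rw [one_add_σ_mul_σ]; simp [Ne.symm hk]

/-- CORE: column sums vanish for every non-empty `S` ⇒ every sign vector carries mass `M / 2^n`. -/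
theorem eqd_core {n : ℕ} {α : Type*} [Fintype α] (m : α → (Fin n → Bool) → ℤ)
    (hcol : ∀ S : Finset (Fin n), S.Nonempty → ∑ z, ∑ a, m z a * chi S a = 0) (s : Fin n → Bool) :
    (2 : ℤ) ^ n * ∑ z, m z s = ∑ z, ∑ a, m z a := by
  -- 2^n N_s = Σ_z Σ_a m z a · (Σ_S χ_S(s) χ_S(a))
  have h1 : (2 : ℤ) ^ n * ∑ z, m z s = ∑ z, ∑ a, m z a * (∑ S ∈ (univ : Finset (Fin n)).powerset, chi S s * chi S a) := by
    rw [Finset.mul_sum]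
    refine Finset.sum_congr rfl (fun z _ => ?_)
    rw [Finset.sum_eq_single s]
    · rw [orth]; simp [mul_comm]
    · intro a _ ha; rw [orth]; simp [ha]
    · intro hs; exact absurd (Finset.mem_univ s) hs
  -- exchange: = Σ_S χ_S(s) · (Σ_z Σ_a m z a χ_S(a))
  have h2 : ∑ z, ∑ a, m z a * (∑ S ∈ (univ : Finset (Fin n)).powerset, chi S s * chi S a)
      = ∑ S ∈ (univ : Finset (Fin n)).powerset, chi S s * ∑ z, ∑ a, m z a * chi S a := by
    calc ∑ z, ∑ a, m z a * (∑ S ∈ (univ : Finset (Fin n)).powerset, chi S s * chi S a)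
        = ∑ z, ∑ a, ∑ S ∈ (univ : Finset (Fin n)).powerset, chi S s * (m z a * chi S a) := by
          refine Finset.sum_congr rfl (fun z _ => Finset.sum_congr rfl (fun a _ => ?_))
          rw [Finset.mul_sum]
          exact Finset.sum_congr rfl (fun S _ => by ring)
      _ = ∑ z, ∑ S ∈ (univ : Finset (Fin n)).powerset, ∑ a, chi S s * (m z a * chi S a) := by
          exact Finset.sum_congr rfl (fun z _ => Finset.sum_comm)
      _ = ∑ S ∈ (univ : Finset (Fin n)).powerset, ∑ z, ∑ a, chi S s * (m z a * chi S a) := Finset.sum_comm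
      _ = ∑ S ∈ (univ : Finset (Fin n)).powerset, chi S s * ∑ z, ∑ a, m z a * chi S a := by
          refine Finset.sum_congr rfl (fun S _ => ?_)
          rw [Finset.mul_sum]
          exact Finset.sum_congr rfl (fun z _ => by rw [Finset.mul_sum])
  rw [h1, h2]
  -- only S = ∅ survives
  rw [Finset.sum_eq_single (∅ : Finset (Fin n))]
  · simp [chi_empty]
  · intro S _ hS
    rw [hcol S (Finset.nonempty_iff_ne_empty.mpr hS)]; simp
  · intro h; exact absurd (Finset.empty_mem_powerset _) h

/-- `(M_S)` fibre by fibre (fibres of the restriction map `z ↦ z|_S`) gives the vanishing column sum. -/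
theorem colsum_of_fibres {n : ℕ} {β : Type*} [Fintype β] [DecidableEq β]
    (m : (Fin n → β) → (Fin n → Bool) → ℤ) (S : Finset (Fin n))
    (hMS : ∀ zS : S → β, ∑ z ∈ (univ.filter fun z : Fin n → β => (fun k : S => z k) = zS), ∑ a, m z a * chi S a = 0) :
    ∑ z, ∑ a, m z a * chi S a = 0 := by
  rw [← Finset.sum_fiberwise (univ : Finset (Fin n → β)) (fun z : Fin n → β => (fun k : S => z k))
        (fun z => ∑ a, m z a * chi S a)]
  exact Finset.sum_eq_zero (fun zS _ => hMS zS)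

/-- `f(c) + f(c+1) + f(c+2) = f 0 + f 1 + f 2` on `ZMod 3`. -/
lemma f_three_shifts (f : ZMod 3 → ℤ) (c : ZMod 3) : f c + f (c + 1) + f (c + 2) = f 0 + f 1 + f 2 := by
  fin_cases c
  · show f 0 + f 1 + f 2 = f 0 + f 1 + f 2; rfl
  · show f 1 + f 2 + f 0 = f 0 + f 1 + f 2; ring
  · show f 2 + f 0 + f 1 = f 0 + f 1 + f 2; ring

/-- for any `g : ZMod 3 → ℤ` and `n+1 ≥ 1` coordinates: `Σ_{z ∈ (ZMod 3)^(n+1)} g(Σ_k z_k) = 3^n · (g 0 + g 1 + g 2)`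
(the coordinate sum is equidistributed; proved by the translation `z ↦ z + t·e₀`). -/
theorem sum_total (n : ℕ) (g : ZMod 3 → ℤ) :
    ∑ z : Fin (n + 1) → ZMod 3, g (∑ k, z k) = 3 ^ n * (g 0 + g 1 + g 2) := by
  set e : Fin (n + 1) → ZMod 3 := Pi.single 0 1 with he
  have hsum_e : ∑ k, e k = 1 := by simp [he]
  have shift : ∀ t : ZMod 3, ∑ z : Fin (n + 1) → ZMod 3, g (∑ k, z k + t) = ∑ z : Fin (n + 1) → ZMod 3, g (∑ k, z k) := by
    intro t
    have := Fintype.sum_equiv (Equiv.addRight (t • e)) (fun z : Fin (n + 1) → ZMod 3 => g (∑ k, z k + t)) (fun z => g (∑ k, z k))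
    rw [this]
    intro z
    simp only [Equiv.coe_addRight, Pi.add_apply, Pi.smul_apply, smul_eq_mul, Finset.sum_add_distrib]
    congr 1
    rw [← Finset.mul_sum, hsum_e, mul_one]
  have h3 : (3 : ℤ) * ∑ z : Fin (n + 1) → ZMod 3, g (∑ k, z k)
      = ∑ z : Fin (n + 1) → ZMod 3, (g (∑ k, z k) + g (∑ k, z k + 1) + g (∑ k, z k + 2)) := by
    rw [Finset.sum_add_distrib, Finset.sum_add_distrib, shift 1, shift 2]; ring
  have h0 : ∑ z : Fin (n + 1) → ZMod 3, (g (∑ k, z k) + g (∑ k, z k + 1) + g (∑ k, z k + 2))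
      = ∑ _z : Fin (n + 1) → ZMod 3, (g 0 + g 1 + g 2) := Finset.sum_congr rfl (fun z _ => f_three_shifts g _)
  have hcard : (Finset.univ : Finset (Fin (n + 1) → ZMod 3)).card = 3 ^ (n + 1) := by
    rw [Finset.card_univ, Fintype.card_fun, ZMod.card, Fintype.card_fin]
  rw [h0, Finset.sum_const, hcard, nsmul_eq_mul] at h3
  push_cast at h3
  have h3' : (3 : ℤ) * ∑ z : Fin (n + 1) → ZMod 3, g (∑ k, z k) = 3 * (3 ^ n * (g 0 + g 1 + g 2)) := by
    rw [h3]; ring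
  exact mul_left_cancel₀ (by norm_num : (3 : ℤ) ≠ 0) h3'

/-- for `n+1 ≥ 1` coordinates and zero-sum `f`: `Σ_z f(Σ_k z_k) = 0`. -/
theorem sum_f_total_eq_zero (n : ℕ) (f : ZMod 3 → ℤ) (hf : f 0 + f 1 + f 2 = 0) :
    ∑ z : Fin (n + 1) → ZMod 3, f (∑ k, z k) = 0 := by
  rw [sum_total, hf, mul_zero]

/-- `|χ_S(a)| = 1`. -/
lemma abs_chi {n : ℕ} (S : Finset (Fin n)) (a : Fin n → Bool) : |chi S a| = 1 := by
  unfold chi; rw [Finset.abs_prod]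
  exact Finset.prod_eq_one (fun k _ => by unfold σ; split <;> simp)

/-- MASS BOUND from `(T)` alone: a non-negative design has `M ≥ Σ_z |f(Σ z)| = 3^n · (|f 0| + |f 1| + |f 2|)`. -/
theorem mass_lower_bound (n : ℕ) (m : (Fin (n + 1) → ZMod 3) → (Fin (n + 1) → Bool) → ℤ) (f : ZMod 3 → ℤ)
    (hm : ∀ z a, 0 ≤ m z a)
    (hT : ∀ z : Fin (n + 1) → ZMod 3, ∑ a, m z a * chi univ a = f (∑ k, z k)) :
    3 ^ n * (|f 0| + |f 1| + |f 2|) ≤ ∑ z, ∑ a, m z a := by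
  have key : ∀ z : Fin (n + 1) → ZMod 3, |f (∑ k, z k)| ≤ ∑ a, m z a := by
    intro z
    rw [← hT z]
    calc |∑ a, m z a * chi univ a| ≤ ∑ a, |m z a * chi univ a| := Finset.abs_sum_le_sum_abs _ _
      _ = ∑ a, m z a := by
          refine Finset.sum_congr rfl (fun a _ => ?_)
          rw [abs_mul, abs_of_nonneg (hm z a), abs_chi, mul_one]
  calc 3 ^ n * (|f 0| + |f 1| + |f 2|) = ∑ z : Fin (n + 1) → ZMod 3, |f (∑ k, z k)| :=
        (sum_total n (fun c => |f c|)).symm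
    _ ≤ ∑ z, ∑ a, m z a := Finset.sum_le_sum (fun z _ => key z)

/-- THEOREM EQD in the model's own terms: sites `(ZMod 3)^(n+1)`, axioms `(M_S)` (fibre sums, proper
non-empty `S`) and `(T)` with zero-sum `f`; conclusion `2^(n+1) · N_s = M` for every sign vector `s`. -/
theorem eqd (n : ℕ) (m : (Fin (n + 1) → ZMod 3) → (Fin (n + 1) → Bool) → ℤ) (f : ZMod 3 → ℤ)
    (hf : f 0 + f 1 + f 2 = 0)
    (hM : ∀ S : Finset (Fin (n + 1)), S.Nonempty → S ≠ univ →
      ∀ zS : S → ZMod 3, ∑ z ∈ (univ.filter fun z : Fin (n + 1) → ZMod 3 => (fun k : S => z k) = zS),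
        ∑ a, m z a * chi S a = 0)
    (hT : ∀ z : Fin (n + 1) → ZMod 3, ∑ a, m z a * chi univ a = f (∑ k, z k))
    (s : Fin (n + 1) → Bool) :
    (2 : ℤ) ^ (n + 1) * ∑ z, m z s = ∑ z, ∑ a, m z a := by
  apply eqd_core
  intro S hS
  by_cases hU : S = univ
  · subst hU
    simp_rw [hT]
    exact sum_f_total_eq_zero n f hf
  · exact colsum_of_fibres m S (hM S hS hU)

/-- COROLLARY: `2^(n+1) ∣ M`. -/
theorem two_pow_dvd_mass (n : ℕ) (m : (Fin (n + 1) → ZMod 3) → (Fin (n + 1) → Bool) → ℤ) (f : ZMod 3 → ℤ)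
    (hf : f 0 + f 1 + f 2 = 0)
    (hM : ∀ S : Finset (Fin (n + 1)), S.Nonempty → S ≠ univ →
      ∀ zS : S → ZMod 3, ∑ z ∈ (univ.filter fun z : Fin (n + 1) → ZMod 3 => (fun k : S => z k) = zS),
        ∑ a, m z a * chi S a = 0)
    (hT : ∀ z : Fin (n + 1) → ZMod 3, ∑ a, m z a * chi univ a = f (∑ k, z k)) :
    (2 : ℤ) ^ (n + 1) ∣ ∑ z, ∑ a, m z a :=
  ⟨∑ z, m z (fun _ => false), (eqd n m f hf hM hT (fun _ => false)).symm⟩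

/-- COROLLARY (n = 4, the g = 8 slot): `16 ∣ M` and `M ≥ 54`, hence `M ≥ 64` — THEOREM EQD's half of «M_min(4) = 64»
(the other half is the exhibited, exactly verified design of mass 64). Here `|f|` has total mass 2, e.g. `f = (1,-1,0)`. -/
theorem mass_ge_64_at_n4 (m : (Fin 4 → ZMod 3) → (Fin 4 → Bool) → ℤ) (f : ZMod 3 → ℤ)
    (hf : f 0 + f 1 + f 2 = 0) (habs : |f 0| + |f 1| + |f 2| = 2) (hm : ∀ z a, 0 ≤ m z a)
    (hM : ∀ S : Finset (Fin 4), S.Nonempty → S ≠ univ →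
      ∀ zS : S → ZMod 3, ∑ z ∈ (univ.filter fun z : Fin 4 → ZMod 3 => (fun k : S => z k) = zS),
        ∑ a, m z a * chi S a = 0)
    (hT : ∀ z : Fin 4 → ZMod 3, ∑ a, m z a * chi univ a = f (∑ k, z k)) :
    64 ≤ ∑ z, ∑ a, m z a := by
  have h1 : (2 : ℤ) ^ (3 + 1) ∣ ∑ z, ∑ a, m z a := two_pow_dvd_mass 3 m f hf hM hT
  have h2 : (3 : ℤ) ^ 3 * (|f 0| + |f 1| + |f 2|) ≤ ∑ z, ∑ a, m z a := mass_lower_bound 3 m f hm hT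
  rw [habs] at h2
  obtain ⟨t, ht⟩ := h1
  have e16 : (2 : ℤ) ^ (3 + 1) = 16 := by norm_num
  have e27 : (3 : ℤ) ^ 3 = 27 := by norm_num
  rw [e16] at ht
  rw [e27] at h2
  omega


/-! ## The exhibited design of mass 64 at `n = 4` (HiGHS `hi_main4_min_s0.design.json`, t-22 g4 job j169231; 64 atoms of
multiplicity 1), re-verified here by kernel `decide` (≈ 60 s; no axioms beyond the standard three). -/

/-- the slanted alphabet `f = (1, -1, 0)` on `ZMod 3`. -/
def fslant (c : ZMod 3) : ℤ := if c = 0 then 1 else if c = 1 then -1 else 0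

/-- site code `27 z₀ + 9 z₁ + 3 z₂ + z₃` and sign code `Σ_k [a_k] 2^k` (`a_k = true` ↔ `s_k = -1`). -/
def zcode (z : Fin 4 → ZMod 3) : ℕ := (z 0).val * 27 + (z 1).val * 9 + (z 2).val * 3 + (z 3).val
/-- sign code `Σ_k [a_k] 2^k`. -/
def acode (a : Fin 4 → Bool) : ℕ := (if a 0 then 1 else 0) + (if a 1 then 2 else 0) + (if a 2 then 4 else 0) + (if a 3 then 8 else 0)

/-- the 64 atoms (site code, sign code). -/
def D64 : List (ℕ × ℕ) := [(0, 6), (1, 13), (2, 2), (2, 10), (3, 14), (4, 4), (4, 12), (5, 0), (7, 12), (8, 8), (9, 7), (11, 3), (13, 12), (14, 13), (15, 5), (16, 4), (17, 1), (17, 5), (19, 9), (20, 11), (21, 15), (22, 8), (24, 13), (26, 9), (27, 14), (29, 15), (31, 6), (32, 2), (33, 12), (34, 4), (35, 0), (35, 13), (37, 5), (38, 7), (39, 15), (40, 14), (42, 7), (44, 5), (45, 6), (46, 1), (48, 11), (50, 10), (51, 3), (51, 4), (52, 0), (53, 1), (55, 15), (56, 11), (57, 10), (58, 14), (60, 8),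 (62, 9), (63, 3), (64, 7), (66, 11), (68, 9), (70, 6), (71, 1), (72, 2), (74, 3), (76, 10), (77, 8), (78, 0), (79, 2)]

/-- the design as a function. -/
def m64 (z : Fin 4 → ZMod 3) (a : Fin 4 → Bool) : ℤ := ((D64.count (zcode z, acode a) : ℕ) : ℤ)

set_option maxHeartbeats 400000000 in
set_option maxRecDepth 200000 in
/-- the exhibited design satisfies `m ≥ 0`, `M = 64`, every `(M_S)` fibre identity and `(T)` with `f = (1,-1,0)`. -/
theorem design64_valid :
    (∀ z a, 0 ≤ m64 z a) ∧ (∑ z, ∑ a, m64 z a = 64) ∧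
    (∀ S : Finset (Fin 4), S.Nonempty → S ≠ univ →
      ∀ zS : S → ZMod 3, ∑ z ∈ (univ.filter fun z : Fin 4 → ZMod 3 => (fun k : S => z k) = zS),
        ∑ a, m64 z a * chi S a = 0) ∧
    (∀ z : Fin 4 → ZMod 3, ∑ a, m64 z a * chi univ a = fslant (∑ k, z k)) := by
  refine ⟨fun z a => by unfold m64; positivity, ?_, ?_, ?_⟩
  · decide
  · decide
  · decide

/-- **M_min(4) = 64** in the slanted-alphabet model with `f = (1,-1,0)`: every non-negative integral design has mass `≥ 64`
(THEOREM EQD + the `(T)` mass bound, kernel-checked above) and the exhibited design has mass exactly `64`. -/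
theorem Mmin4_eq_64 :
    (∀ m : (Fin 4 → ZMod 3) → (Fin 4 → Bool) → ℤ, (∀ z a, 0 ≤ m z a) →
      (∀ S : Finset (Fin 4), S.Nonempty → S ≠ univ →
        ∀ zS : S → ZMod 3, ∑ z ∈ (univ.filter fun z : Fin 4 → ZMod 3 => (fun k : S => z k) = zS),
          ∑ a, m z a * chi S a = 0) →
      (∀ z : Fin 4 → ZMod 3, ∑ a, m z a * chi univ a = fslant (∑ k, z k)) →
      64 ≤ ∑ z, ∑ a, m z a) ∧
    (∃ m : (Fin 4 → ZMod 3) → (Fin 4 → Bool) → ℤ, (∀ z a, 0 ≤ m z a) ∧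
      (∀ S : Finset (Fin 4), S.Nonempty → S ≠ univ →
        ∀ zS : S → ZMod 3, ∑ z ∈ (univ.filter fun z : Fin 4 → ZMod 3 => (fun k : S => z k) = zS),
          ∑ a, m z a * chi S a = 0) ∧
      (∀ z : Fin 4 → ZMod 3, ∑ a, m z a * chi univ a = fslant (∑ k, z k)) ∧
      ∑ z, ∑ a, m z a = 64) := by
  refine ⟨fun m hm hM hT => mass_ge_64_at_n4 m fslant (by decide) (by decide) hm hM hT, ?_⟩
  obtain ⟨h0, hM64, hMS, hT⟩ := design64_valid
  exact ⟨m64, h0, hMS, hT, hM64⟩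


/-! ## Any W-alive alphabet: for every zero-sum `f ≠ 0` the same bounds hold (|f|₁ ≥ 2 suffices, since `2^(n+1) ∣ M`). -/

/-- a zero-sum `f ≠ 0` on `ZMod 3` has `|f|₁ ≥ 2`. -/
lemma abs_total_ge_two (f : ZMod 3 → ℤ) (hf : f 0 + f 1 + f 2 = 0) (hne : ¬ (f 0 = 0 ∧ f 1 = 0 ∧ f 2 = 0)) :
    2 ≤ |f 0| + |f 1| + |f 2| := by
  rcases abs_cases (f 0) with ⟨h0, _⟩ | ⟨h0, _⟩ <;> rcases abs_cases (f 1) with ⟨h1, _⟩ | ⟨h1, _⟩ <;>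
    rcases abs_cases (f 2) with ⟨h2, _⟩ | ⟨h2, _⟩ <;> omega

/-- n = 4, ANY zero-sum `f ≠ 0` (= every W-alive alphabet): `M ≥ 64`. -/
theorem mass_ge_64_at_n4_anyf (m : (Fin 4 → ZMod 3) → (Fin 4 → Bool) → ℤ) (f : ZMod 3 → ℤ)
    (hf : f 0 + f 1 + f 2 = 0) (hne : ¬ (f 0 = 0 ∧ f 1 = 0 ∧ f 2 = 0)) (hm : ∀ z a, 0 ≤ m z a)
    (hM : ∀ S : Finset (Fin 4), S.Nonempty → S ≠ univ →
      ∀ zS : S → ZMod 3, ∑ z ∈ (univ.filter fun z : Fin 4 → ZMod 3 => (fun k : S => z k) = zS),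
        ∑ a, m z a * chi S a = 0)
    (hT : ∀ z : Fin 4 → ZMod 3, ∑ a, m z a * chi univ a = f (∑ k, z k)) :
    64 ≤ ∑ z, ∑ a, m z a := by
  have h1 : (2 : ℤ) ^ (3 + 1) ∣ ∑ z, ∑ a, m z a := two_pow_dvd_mass 3 m f hf hM hT
  have h2 : (3 : ℤ) ^ 3 * (|f 0| + |f 1| + |f 2|) ≤ ∑ z, ∑ a, m z a := mass_lower_bound 3 m f hm hT
  have hA := abs_total_ge_two f hf hne
  obtain ⟨t, ht⟩ := h1
  have e16 : (2 : ℤ) ^ (3 + 1) = 16 := by norm_num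
  have e27 : (3 : ℤ) ^ 3 = 27 := by norm_num
  rw [e16] at ht
  rw [e27] at h2
  omega

/-- **HEADLINE. M_min(4) = 64 over ALL W-alive alphabets**: for every zero-sum `f ≠ 0`, every non-negative integral design on `(ZMod 3)^4 × Bool^4`
satisfying (M_S) (all non-empty proper `S`, all fibres) and (T) has total mass `≥ 64`; and the exhibited design (`f = (1,−1,0)`) has mass `64`.
(The bridge «h-free ∧ pure-Weil ∧ W-alive positive slanted design ⟺ (M_S) ∧ (T) with zero-sum f ≠ 0» is s0-3's MODEL THEOREM, slant/README §1 — NOT part of this file.) -/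
theorem Mmin4_eq_64_all_alphabets :
    (∀ f : ZMod 3 → ℤ, f 0 + f 1 + f 2 = 0 → ¬ (f 0 = 0 ∧ f 1 = 0 ∧ f 2 = 0) →
      ∀ m : (Fin 4 → ZMod 3) → (Fin 4 → Bool) → ℤ, (∀ z a, 0 ≤ m z a) →
      (∀ S : Finset (Fin 4), S.Nonempty → S ≠ univ →
        ∀ zS : S → ZMod 3, ∑ z ∈ (univ.filter fun z : Fin 4 → ZMod 3 => (fun k : S => z k) = zS),
          ∑ a, m z a * chi S a = 0) →
      (∀ z : Fin 4 → ZMod 3, ∑ a, m z a * chi univ a = f (∑ k, z k)) →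
      64 ≤ ∑ z, ∑ a, m z a) ∧
    (fslant 0 + fslant 1 + fslant 2 = 0 ∧ ¬ (fslant 0 = 0 ∧ fslant 1 = 0 ∧ fslant 2 = 0) ∧
      (∀ z a, 0 ≤ m64 z a) ∧
      (∀ S : Finset (Fin 4), S.Nonempty → S ≠ univ →
        ∀ zS : S → ZMod 3, ∑ z ∈ (univ.filter fun z : Fin 4 → ZMod 3 => (fun k : S => z k) = zS),
          ∑ a, m64 z a * chi S a = 0) ∧
      (∀ z : Fin 4 → ZMod 3, ∑ a, m64 z a * chi univ a = fslant (∑ k, z k)) ∧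
      ∑ z, ∑ a, m64 z a = 64) := by
  refine ⟨fun f hf hne m hm hM hT => mass_ge_64_at_n4_anyf m f hf hne hm hM hT, by decide, by decide, ?_⟩
  obtain ⟨h0, hM64, hMS, hT⟩ := design64_valid
  exact ⟨h0, hMS, hT, hM64⟩


end Summit.Ventures.HSemireg.EQD
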